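import Summits.QuantumFields.YangMills.Theorems.FluctuationComparisonRegPrIntLS2BetaOrbitDistComparison
import Literature.MathematicalPhysics.QuantumFieldTheory.Balaban1983to89.T3Thm1Carrier
import HarnessLib

/-!
# (RG-K) The letters (E) and ISOL∘(δ) from «at most one critical orbit» — definition-free glue

Helper for crux `stmt-QuantumFields-20520` (`Theses.UnitScaleTilt.FluctuationComparisonRegPrIntL`), the (T)-chain of LINE
`semiclassical_s2beta` (cell `ym3-torus`).  Two of the chain's displayed letters are statements about PRINT'S (4)-ORBIT
([Balaban1985Variational] (4) p.278: gauge transformations `u` of the fine lattice with `u↓ ≡ 1` on the comparison lattice — the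
«residual», descent-preserving transformations of ✓`…S2BetaResidualGauge`):

* (E) of ✓`…S2BetaOrbitDistComparison.iInf_orbitDistSq_le_of_equivariant_of_lipschitz` — «`X` lies ON the residual orbit of `U₁`»,
  i.e. the orbit functional `D(X;U₁) := ⨅_{w residual} Σ_ℓ dist1 (X ℓ·((w•U₁) ℓ)⁻¹)²` vanishes;
* ISOL∘(δ) of ✓`…S2BetaTubeGrowthOfIsolated.tubeGrowth_of_pos_of_isolated` (the `hisol` binder, = (T3) `…TubeGrowthOfHessianPosDock` :111–121)
  — «inside the `δ`-tube of the residual orbit of the base point `U₀`, every point of the closed good fibre with `A ≤ min` lies ON that orbit».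

§1 ★ `iInf_orbitDistSq_le_zero_of_sameOrbit`: print's `SameOrbit X U₁` (lit ✓`T3Thm1Carrier.SameOrbit`: `U₁ = u•X`, `u↓ ≡ 1`) gives
`D(X;U₁) ≤ 0` — so (E) IS the (4)-orbit statement, and [Balaban1985Variational] Prop. 7 clause 1 («at most one critical orbit», lit
✓`VarProblemX.AtMostOneCriticalOrbit` of ✓`varProblem3`) supplies it wherever both points are R2-critical over one datum (cell: px17 g15's
`atMostOneCriticalOrbit_of_centralStab_five` at every datum with central stabiliser, `L ≥ 5`, from orbit growth — no analytic hypothesis).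
§2 ★★ `isol_of_atMostOneCriticalOrbit`: Prop. 7 clause 1 at `(ε₀, V)` + «the base point `U₀` is an `ε₀`-regular minimiser» + ONE regime
letter `hreg` («a tube point of the closed good fibre with `A ≤ min` is `ε₀`-regular») ⟹ the ISOL∘(δ) text VERBATIM, for EVERY `δ`: such a
point is a minimiser over `regFibrePr ε₀ V` (lit ✓`minActionRegPr_le`), hence R2-critical at `e := ε₀`, hence on the (4)-orbit of `U₀`, hence
at orbit distance `0` (§1).

HONEST: order-of-quantifiers glue; Prop. 7 clause 1 and `hreg` are hypotheses here, NOT proved; this file proves NO stub of the line —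
TUBE-REG∘, GAP♯∘, EXW∘, S2β and crux 20520 stay OPEN; rung R3 (YM₃ on T³) is NOT d = 4, NOT infinite volume, NOT a mass gap, NOT Clay;
the Yang–Mills mass gap is NOT proved.
-/

set_option autoImplicit false

noncomputable section

open Set
open Literature.MathematicalPhysics.QuantumFieldTheory.Balaban1983to89
open Literature.MathematicalPhysics.QuantumFieldTheory.Balaban1983to89.T3ContinuumYM3Torus
open Literature.MathematicalPhysics.QuantumFieldTheory.Balaban1983to89.T3UnitLawDensityEML
open Literature.MathematicalPhysics.QuantumFieldTheory.Balaban1983to89.T3UnitScaleTilt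
open Literature.MathematicalPhysics.QuantumFieldTheory.Balaban1983to89.T3TiltDescent
open Literature.MathematicalPhysics.QuantumFieldTheory.Balaban1983to89.T3ConstrainedMinimiser (fibre)
open Literature.MathematicalPhysics.QuantumFieldTheory.Balaban1983to89.T3PrintedRegularMinimiser
open Literature.MathematicalPhysics.QuantumFieldTheory.Balaban1983to89.T3PrintedRegularOrbits
open Literature.MathematicalPhysics.QuantumFieldTheory.Balaban1983to89.T3Thm1Carrier
open scoped Literature.MathematicalPhysics.QuantumFieldTheory.Balaban1983to89.T3OrbitAverage
open Summit.QuantumFields.YangMills.Theorems.FluctuationComparisonRegPrIntLS2BetaResidualGauge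
open Summit.QuantumFields.YangMills.Theorems.FluctuationComparisonRegPrIntLS2BetaOrbitDistComparison
  (iInf_orbitDistSq_le_of_residual iInf_orbitDistSq_nonneg)

namespace Summit.QuantumFields.YangMills.Theorems.FluctuationComparisonRegPrIntLS2BetaIsolOfCriticalOrbitUnique

variable (F : T3Family) {J K : ℕ} (hJK : J ≤ K)

/-! ## §1 (E) is print's (4)-orbit statement -/

/-- ★ **SAME (4)-ORBIT ⇒ VANISHING ORBIT DISTANCE**: if `U₁ = u•X` with `u↓ ≡ 1` (lit `SameOrbit X U₁`) then
`D(X;U₁) = ⨅_{w residual} Σ_ℓ dist1 (X ℓ·((w•U₁) ℓ)⁻¹)² ≤ 0` — test the residual `u⁻¹` (✓`residual_of_descTransf_eq_one`, ✓`residual_inv`):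
`u⁻¹•U₁ = X` (✓`gaugeAct_inv_gaugeAct`). [cite: Balaban1985Variational, (4) p.278, Thm 1 (8)-(10) p.279] -/
theorem iInf_orbitDistSq_le_zero_of_sameOrbit {X U₁ : GaugeField (F.P K) 0 (Matrix.specialUnitaryGroup (Fin 2) ℂ)}
    (h : SameOrbit F J K hJK X U₁) :
    (⨅ w' : {w : Site (F.P K) 0 → Matrix.specialUnitaryGroup (Fin 2) ℂ |
          ∀ U : GaugeField (F.P K) 0 (Matrix.specialUnitaryGroup (Fin 2) ℂ),
            descendTo F ℰp J K hJK (GaugeField.gaugeAct w U) = descendTo F ℰp J K hJK U},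
        ∑ ℓ : PBond (F.P K) 0,
          dist1 (X ℓ * ((GaugeField.gaugeAct (w' : Site (F.P K) 0 → Matrix.specialUnitaryGroup (Fin 2) ℂ) U₁) ℓ)⁻¹) ^ 2) ≤ 0 := by
  obtain ⟨u, hu1, rfl⟩ := h
  have hres := residual_inv F hJK (residual_of_descTransf_eq_one F hJK hu1)
  refine (iInf_orbitDistSq_le_of_residual F hJK X (GaugeField.gaugeAct u X) hres).trans (le_of_eq ?_)
  rw [gaugeAct_inv_gaugeAct]
  exact Finset.sum_eq_zero fun ℓ _ => by rw [mul_inv_cancel, GaugeGroup.dist1_one, zero_pow two_ne_zero]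

/-- The flipped orientation: `SameOrbit U₁ X` also gives `D(X;U₁) ≤ 0` (test the residual `u` itself: `u•U₁ = X`).
[cite: Balaban1985Variational, (4) p.278, Thm 1 (8)-(10) p.279] -/
theorem iInf_orbitDistSq_le_zero_of_sameOrbit' {X U₁ : GaugeField (F.P K) 0 (Matrix.specialUnitaryGroup (Fin 2) ℂ)}
    (h : SameOrbit F J K hJK U₁ X) :
    (⨅ w' : {w : Site (F.P K) 0 → Matrix.specialUnitaryGroup (Fin 2) ℂ |
          ∀ U : GaugeField (F.P K) 0 (Matrix.specialUnitaryGroup (Fin 2) ℂ),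
            descendTo F ℰp J K hJK (GaugeField.gaugeAct w U) = descendTo F ℰp J K hJK U},
        ∑ ℓ : PBond (F.P K) 0,
          dist1 (X ℓ * ((GaugeField.gaugeAct (w' : Site (F.P K) 0 → Matrix.specialUnitaryGroup (Fin 2) ℂ) U₁) ℓ)⁻¹) ^ 2) ≤ 0 := by
  obtain ⟨u, hu1, rfl⟩ := h
  have hres := residual_of_descTransf_eq_one F hJK hu1
  refine (iInf_orbitDistSq_le_of_residual F hJK (GaugeField.gaugeAct u U₁) U₁ hres).trans (le_of_eq ?_)
  exact Finset.sum_eq_zero fun ℓ _ => by rw [mul_inv_cancel, GaugeGroup.dist1_one, zero_pow two_ne_zero]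

/-- The orbit functional vanishes exactly: `SameOrbit U₀ U ⇒ D(U;U₀) = 0`. [cite: Balaban1985Variational, (4) p.278, Thm 1 (8)-(10) p.279] -/
theorem iInf_orbitDistSq_eq_zero_of_sameOrbit {U₀ U : GaugeField (F.P K) 0 (Matrix.specialUnitaryGroup (Fin 2) ℂ)}
    (h : SameOrbit F J K hJK U₀ U) :
    (⨅ w' : {w : Site (F.P K) 0 → Matrix.specialUnitaryGroup (Fin 2) ℂ |
          ∀ U : GaugeField (F.P K) 0 (Matrix.specialUnitaryGroup (Fin 2) ℂ),
            descendTo F ℰp J K hJK (GaugeField.gaugeAct w U) = descendTo F ℰp J K hJK U},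
        ∑ ℓ : PBond (F.P K) 0,
          dist1 (U ℓ * ((GaugeField.gaugeAct (w' : Site (F.P K) 0 → Matrix.specialUnitaryGroup (Fin 2) ℂ) U₀) ℓ)⁻¹) ^ 2) = 0 :=
  le_antisymm (iInf_orbitDistSq_le_zero_of_sameOrbit' F hJK h) (iInf_orbitDistSq_nonneg F hJK U U₀)

/-! ## §2 ISOL∘(δ) from «at most one critical orbit» -/

/-- An `ε₀`-regular fibre point with `A ≤ min over regFibrePr ε₀ V` is R2-critical (`varProblem3.IsCritical`, at `e := ε₀`).
[cite: Balaban1985Variational, (5)-(7) p.278] -/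
theorem isCritical_of_le_minActionRegPr {ε₀ : ℝ} (hε₀ : 0 < ε₀)
    {V : GaugeField (F.P J) 0 (Matrix.specialUnitaryGroup (Fin 2) ℂ)} {U : GaugeField (F.P K) 0 (Matrix.specialUnitaryGroup (Fin 2) ℂ)}
    (hU : U ∈ regFibrePr F J K hJK ε₀ V) (hA : wilsonAction4 U ≤ minActionRegPr F J K hJK ε₀ V) :
    (varProblem3 F J K hJK).IsCritical V U :=
  ⟨ε₀, hε₀, hU, fun _ hW => hA.trans (minActionRegPr_le F hW)⟩

/-- ★★ **ISOL∘(δ) ⟸ PROP. 7 CLAUSE 1 + «tube minimisers are `ε₀`-regular»** — for EVERY `δ`.  At a datum `V` where the variational problem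
has at most one critical orbit in `(6)(ε₀)` (lit `(varProblem3 F J K hJK).AtMostOneCriticalOrbit ε₀ V` — [Balaban1985Variational] Prop. 7
clause 1; in the cell a THEOREM at every datum with central stabiliser, `L ≥ 5`), with an `ε₀`-regular base point `U₀` realising the regular
minimum, and the regime letter `hreg` (a point of the closed good fibre inside the `δ`-tube of the residual orbit of `U₀` with `A ≤ min` is
`ε₀`-regular): the `hisol` binder of ✓`tubeGrowth_of_pos_of_isolated` VERBATIM — every such point has orbit distance `0` from `U₀`.
[cite: Balaban1985Variational, Prop. 7 p.299, (4)-(6) p.278, Thm 1 (8)-(10) p.279] -/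
theorem isol_of_atMostOneCriticalOrbit {γ b₀ p₀ ε₀ : ℝ} (hε₀ : 0 < ε₀)
    (V : GaugeField (F.P J) 0 (Matrix.specialUnitaryGroup (Fin 2) ℂ)) (U₀ : GaugeField (F.P K) 0 (Matrix.specialUnitaryGroup (Fin 2) ℂ)) (δ : ℝ)
    (h1 : (varProblem3 F J K hJK).AtMostOneCriticalOrbit ε₀ V)
    (hU₀ : U₀ ∈ regFibrePr F J K hJK ε₀ V) (hmin : wilsonAction4 U₀ = minActionRegPr F J K hJK ε₀ V)
    (hreg : ∀ U ∈ closure (fibre F ℰp J K hJK V ∩ histGood F ℰp (θBal F.L γ b₀ p₀) K J),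
        (∃ w : Site (F.P K) 0 → Matrix.specialUnitaryGroup (Fin 2) ℂ,
          (∀ U'' : GaugeField (F.P K) 0 (Matrix.specialUnitaryGroup (Fin 2) ℂ),
              descendTo F ℰp J K hJK (GaugeField.gaugeAct w U'') = descendTo F ℰp J K hJK U'') ∧
            ∀ ℓ : PBond (F.P K) 0, dist1 (U ℓ * ((GaugeField.gaugeAct w U₀) ℓ)⁻¹) ≤ δ) →
        wilsonAction4 U ≤ minActionRegPr F J K hJK ε₀ V → U ∈ regFibrePr F J K hJK ε₀ V) :
    ∀ U ∈ closure (fibre F ℰp J K hJK V ∩ histGood F ℰp (θBal F.L γ b₀ p₀) K J),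
        (∃ w : Site (F.P K) 0 → Matrix.specialUnitaryGroup (Fin 2) ℂ,
          (∀ U'' : GaugeField (F.P K) 0 (Matrix.specialUnitaryGroup (Fin 2) ℂ),
              descendTo F ℰp J K hJK (GaugeField.gaugeAct w U'') = descendTo F ℰp J K hJK U'') ∧
            ∀ ℓ : PBond (F.P K) 0, dist1 (U ℓ * ((GaugeField.gaugeAct w U₀) ℓ)⁻¹) ≤ δ) →
        wilsonAction4 U ≤ minActionRegPr F J K hJK ε₀ V →
        (⨅ w : {w : Site (F.P K) 0 → Matrix.specialUnitaryGroup (Fin 2) ℂ |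
            ∀ U : GaugeField (F.P K) 0 (Matrix.specialUnitaryGroup (Fin 2) ℂ),
              descendTo F ℰp J K hJK (GaugeField.gaugeAct w U) = descendTo F ℰp J K hJK U},
          ∑ ℓ : PBond (F.P K) 0,
            dist1 (U ℓ * ((GaugeField.gaugeAct (w : Site (F.P K) 0 → Matrix.specialUnitaryGroup (Fin 2) ℂ) U₀) ℓ)⁻¹) ^ 2) = 0 := by
  intro U hU htube hA
  have hUreg := hreg U hU htube hA
  have hc₀ : (varProblem3 F J K hJK).IsCritical V U₀ := isCritical_of_le_minActionRegPr F hJK hε₀ hU₀ hmin.le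
  have hc : (varProblem3 F J K hJK).IsCritical V U := isCritical_of_le_minActionRegPr F hJK hε₀ hUreg hA
  have hfib₀ : U₀ ∈ fibre F ℰp J K hJK V := ((mem_regFibrePr_iff F).1 hU₀).1
  have hfib : U ∈ fibre F ℰp J K hJK V := ((mem_regFibrePr_iff F).1 hUreg).1
  have hin₀ : RegPr F J K ε₀ U₀ := ((mem_regFibrePr_iff F).1 hU₀).2
  have hin : RegPr F J K ε₀ U := ((mem_regFibrePr_iff F).1 hUreg).2
  exact iInf_orbitDistSq_eq_zero_of_sameOrbit F hJK (h1 U₀ U hin₀ hfib₀ hc₀ hin hfib hc)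

/-- ★★ **THE SAME WITH THE REGIME LETTER IN ITS STRONGEST (δ-FREE) FORM**: if the closed good fibre lies inside `regFibrePr ε₀ V` outright, ISOL∘(δ)
holds for every `δ` with no tube condition used. [cite: Balaban1985Variational, Prop. 7 p.299, (4)-(6) p.278] -/
theorem isol_of_atMostOneCriticalOrbit_of_subset {γ b₀ p₀ ε₀ : ℝ} (hε₀ : 0 < ε₀)
    (V : GaugeField (F.P J) 0 (Matrix.specialUnitaryGroup (Fin 2) ℂ)) (U₀ : GaugeField (F.P K) 0 (Matrix.specialUnitaryGroup (Fin 2) ℂ)) (δ : ℝ)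
    (h1 : (varProblem3 F J K hJK).AtMostOneCriticalOrbit ε₀ V)
    (hU₀ : U₀ ∈ regFibrePr F J K hJK ε₀ V) (hmin : wilsonAction4 U₀ = minActionRegPr F J K hJK ε₀ V)
    (hsub : closure (fibre F ℰp J K hJK V ∩ histGood F ℰp (θBal F.L γ b₀ p₀) K J) ⊆ regFibrePr F J K hJK ε₀ V) :
    ∀ U ∈ closure (fibre F ℰp J K hJK V ∩ histGood F ℰp (θBal F.L γ b₀ p₀) K J),
        (∃ w : Site (F.P K) 0 → Matrix.specialUnitaryGroup (Fin 2) ℂ,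
          (∀ U'' : GaugeField (F.P K) 0 (Matrix.specialUnitaryGroup (Fin 2) ℂ),
              descendTo F ℰp J K hJK (GaugeField.gaugeAct w U'') = descendTo F ℰp J K hJK U'') ∧
            ∀ ℓ : PBond (F.P K) 0, dist1 (U ℓ * ((GaugeField.gaugeAct w U₀) ℓ)⁻¹) ≤ δ) →
        wilsonAction4 U ≤ minActionRegPr F J K hJK ε₀ V →
        (⨅ w : {w : Site (F.P K) 0 → Matrix.specialUnitaryGroup (Fin 2) ℂ |
            ∀ U : GaugeField (F.P K) 0 (Matrix.specialUnitaryGroup (Fin 2) ℂ),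
              descendTo F ℰp J K hJK (GaugeField.gaugeAct w U) = descendTo F ℰp J K hJK U},
          ∑ ℓ : PBond (F.P K) 0,
            dist1 (U ℓ * ((GaugeField.gaugeAct (w : Site (F.P K) 0 → Matrix.specialUnitaryGroup (Fin 2) ℂ) U₀) ℓ)⁻¹) ^ 2) = 0 :=
  isol_of_atMostOneCriticalOrbit F hJK hε₀ V U₀ δ h1 hU₀ hmin fun _ hU _ _ => hsub hU

end Summit.QuantumFields.YangMills.Theorems.FluctuationComparisonRegPrIntLS2BetaIsolOfCriticalOrbitUnique

end
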